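import Mathlib
import HarnessLib
import Literature.ModelTheory.FiniteModelTheory.StructCkEquiv
import Literature.RingTheory.TwoVariableSeries.Basic
import Summits.ValiantsHypothesis.ValiantsHypothesis.Theorems.SymmetryDialAffineOrbits
import Summits.ValiantsHypothesis.ValiantsHypothesis.Theorems.SymmetryDialAffinePebble

/-!
# SymmetryDial — rung `k′ = 2` of the pebble criterion `P′` (`AffinePebblePairs`), part 1: the game

`AffinePebblePairs` (`Theorems/SymmetryDialAffinePebble.lean`) asks, for every number `k′` of pebble
pairs, for two `0/1`-matrices on `𝔽₂^d` whose affine matrix structures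
`𝔄(A) = (𝔽₂^d ⊔ (𝔽₂^d)^*; pt, dl, aff, inc, mat_A)` are `k′`-pebble bijectively equivalent while
`per A ≠ per B` (rungs `k′ = 0, 1` are in that file).  This file and its sequel
`SymmetryDialAffinePebbleTwoRung.lean` prove rung `k′ = 2`, the first rung at which Spoiler can
combine a dual pebble with a point pebble.  Witnesses: `A = I + P_σ`, `B = I + P_τ`
(`fg σ (a, b) = [a = b ∨ a = σ b]`) for fixed-point-free `σ, τ` without `2`-cycles; the sequel takes
`d = 3`, `σ` an `8`-cycle, `τ` two `4`-cycles (`per 2 ≠ 4`).  THIS FILE: Duplicator's strategy for two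
pebble pairs (`affinePebbleEquiv_two_fg`, any `d`): keep every pair of pebbled pairs `Good` —
equality-compatible, sort-homogeneous, and `a′ = σ a ↔ b′ = τ b` on pebbled points.  Facing a pebbled
point pair `(x, y)` she plays any permutation extending `x ↦ y, σx ↦ τy, σ⁻¹x ↦ τ⁻¹y`
(`Equiv.Perm.exists_extending_pair`), facing a pebbled dual pair the transposition of the two duals,
facing nothing the identity.  With two pebbled pairs `inc(ξ, a, b)` is only ever tested with `a = b`
(true on both sides) and `aff` only on tuples drawn from two pebbled points, which an element of the
`2`-transitive group `AGL_d(𝔽₂)` (`SymmetryDialAffineOrbits.exists_map_pair`) carries to their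
partners.  Calibration value only (cycle structure of functional digraphs is `C²`-invisible; cf.
Cai–Fürer–Immerman 1992, §6 [CaiFurerImmerman1992]); it fixes the proof pattern (position invariant +
a fresh bijection per move) for higher rungs of the typed game.
-/

set_option linter.dupNamespace false

namespace Summit.ValiantsHypothesis.ValiantsHypothesis.Theorems.SymmetryDialAffinePebbleTwo

open Finset
open Literature.Computability.AlgebraicComplexity
open Literature.ModelTheory.FiniteModelTheory
open SymmetryDialAffinePebble (V AffRel Laff pair RelHolds affStr AffinePebbleEquiv AffinePebblePairs
  eval_perPoly_eq_card)

variable {d : ℕ}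

/-! ### 1. The matrices `I + P_σ` -/

/-- The `0/1` matrix `I + P_σ`: entry `(a, b)` is `1` iff `a = b` or `a = σ b`. -/
def fg (σ : Equiv.Perm (V d)) : V d × V d → Bool := fun ab => decide (ab.1 = ab.2 ∨ ab.1 = σ ab.2)

/-- Entries of `I + P_σ`. -/
theorem fg_true (σ : Equiv.Perm (V d)) (a b : V d) : fg σ (a, b) = true ↔ (a = b ∨ a = σ b) := by
  simp [fg]

/-! ### 2. Duplicator's strategy with two pebble pairs -/

section Game
variable (σ τ : Equiv.Perm (V d))

/-- The invariant between two pebbled pairs `(u, v)` and `(u', v')`: equality-compatible,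
sort-homogeneous (point ↦ point, dual ↦ dual), and `σ`-successor goes with `τ`-successor. -/
structure Good (u v u' v' : V d ⊕ V d) : Prop where
  eq_iff : u = u' ↔ v = v'
  sort : (∃ a b : V d, u = .inl a ∧ v = .inl b) ∨ (∃ ξ η : V d, u = .inr ξ ∧ v = .inr η)
  nb : ∀ a b a' b' : V d, u = .inl a → v = .inl b → u' = .inl a' → v' = .inl b' →
    (a' = σ a ↔ b' = τ b)

/-- Duplicator's positions: every (ordered) pair of pebbled pairs is `Good`. -/
def positions : Set (PebblePosition 2 (V d ⊕ V d) (V d ⊕ V d)) :=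
  {p | ∀ i j u v u' v', p i = some (u, v) → p j = some (u', v') → Good σ τ u v u' v'}

variable {σ τ}

/-- `Fin 2 = {i, i.rev}`. -/
theorem fin2_eq_or_eq_rev (i j : Fin 2) : j = i ∨ j = i.rev := by
  fin_cases i <;> fin_cases j <;> simp [Fin.rev]

/-- A `Good` pair with itself, for a sort-preserving image and fixed-point-free `σ, τ`. -/
theorem good_self (hσ : ∀ x, σ x ≠ x) (hτ : ∀ x, τ x ≠ x) {a b : V d ⊕ V d}
    (hs : (∃ x y : V d, a = .inl x ∧ b = .inl y) ∨ (∃ ξ η : V d, a = .inr ξ ∧ b = .inr η)) :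
    Good σ τ a b a b := by
  refine ⟨by simp, hs, ?_⟩
  intro x y x' y' hx hy hx' hy'
  rw [hx] at hx'; rw [hy] at hy'
  cases Sum.inl_injective hx'; cases Sum.inl_injective hy'
  exact ⟨fun h => absurd h.symm (hσ x), fun h => absurd h.symm (hτ y)⟩

/-- Criterion for an updated position to stay in `positions`. -/
theorem update_mem {p : PebblePosition 2 (V d ⊕ V d) (V d ⊕ V d)} (hp : p ∈ positions σ τ)
    (i : Fin 2) (a b : V d ⊕ V d) (hself : Good σ τ a b a b)
    (hcross : ∀ u v, p i.rev = some (u, v) → Good σ τ a b u v ∧ Good σ τ u v a b) :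
    Function.update p i (some (a, b)) ∈ positions σ τ := by
  intro i' j' u v u' v' hi' hj'
  have fin2_rev_ne : ∀ i : Fin 2, i.rev ≠ i := Literature.RingTheory.TwoVariableSeries.fin2_rev_ne
  rcases fin2_eq_or_eq_rev i i' with h1 | h1 <;> rcases fin2_eq_or_eq_rev i j' with h2 | h2 <;>
    rw [h1] at hi' <;> rw [h2] at hj'
  · rw [Function.update_apply, if_pos rfl] at hi' hj'
    cases hi'; cases hj'; exact hself
  · rw [Function.update_apply, if_pos rfl] at hi'
    rw [Function.update_apply, if_neg (fin2_rev_ne i)] at hj'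
    cases hi'; exact (hcross u' v' hj').1
  · rw [Function.update_apply, if_neg (fin2_rev_ne i)] at hi'
    rw [Function.update_apply, if_pos rfl] at hj'
    cases hj'; exact (hcross u v hi').2
  · rw [Function.update_apply, if_neg (fin2_rev_ne i)] at hi' hj'
    exact hp _ _ _ _ _ _ hi' hj'

/-- **Duplicator's move.** -/
theorem move_mem (hσ : ∀ x, σ x ≠ x) (hσ2 : ∀ x, σ (σ x) ≠ x) (hτ : ∀ x, τ x ≠ x)
    (hτ2 : ∀ x, τ (τ x) ≠ x) {p : PebblePosition 2 (V d ⊕ V d) (V d ⊕ V d)}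
    (hp : p ∈ positions σ τ) (i : Fin 2) :
    ∃ f : (V d ⊕ V d) ≃ (V d ⊕ V d), ∀ a, Function.update p i (some (a, f a)) ∈ positions σ τ := by
  rcases h : p i.rev with _ | ⟨u, v⟩
  · -- no other pebble on the board: the identity
    refine ⟨Equiv.refl _, fun a => update_mem hp i a a (good_self hσ hτ ?_) ?_⟩
    · rcases a with x | ξ
      · exact Or.inl ⟨x, x, rfl, rfl⟩
      · exact Or.inr ⟨ξ, ξ, rfl, rfl⟩
    · intro u v huv; rw [h] at huv; cases huv
  · have hg : Good σ τ u v u v := hp _ _ _ _ _ _ h h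
    rcases hg.sort with ⟨x, y, rfl, rfl⟩ | ⟨ξ, η, rfl, rfl⟩
    · -- the other pebble sits on a point pair `(x, y)`: extend `x ↦ y, σx ↦ τy, σ⁻¹x ↦ τ⁻¹y`
      have hinj : ∀ (ρ : Equiv.Perm (V d)), (∀ x, ρ x ≠ x) → (∀ x, ρ (ρ x) ≠ x) → ∀ z : V d,
          Function.Injective ![z, ρ z, ρ.symm z] := by
        intro ρ h1 h2 z m n hmn
        fin_cases m <;> fin_cases n
        · rfl
        · exact absurd hmn.symm (h1 z)
        · exact absurd ((Equiv.eq_symm_apply ρ).1 hmn) (h1 _)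
        · exact absurd hmn (h1 z)
        · rfl
        · have hmn' : ρ z = ρ.symm z := hmn
          exact absurd (by rw [hmn', Equiv.apply_symm_apply] : ρ (ρ z) = z) (h2 z)
        · exact absurd ((Equiv.eq_symm_apply ρ).1 hmn.symm) (h1 _)
        · have hmn' : ρ z = ρ.symm z := (hmn).symm
          exact absurd (by rw [hmn', Equiv.apply_symm_apply] : ρ (ρ z) = z) (h2 z)
        · rfl
      obtain ⟨g, hg3⟩ := Equiv.Perm.exists_extending_pair ![x, σ x, σ.symm x] ![y, τ y, τ.symm y]
        (hinj σ hσ hσ2 x) (hinj τ hτ hτ2 y)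
      have hgx : g x = y := hg3 0
      have hgσ : g (σ x) = τ y := hg3 1
      have hgσ' : g (σ.symm x) = τ.symm y := hg3 2
      have hsc : ∀ a : V d ⊕ V d, (∃ p q : V d, a = .inl p ∧ Equiv.sumCongr g (Equiv.refl (V d)) a = .inl q)
          ∨ ∃ α β : V d, a = .inr α ∧ Equiv.sumCongr g (Equiv.refl (V d)) a = .inr β := by
        rintro (z | ζ)
        · exact Or.inl ⟨z, g z, rfl, rfl⟩
        · exact Or.inr ⟨ζ, ζ, rfl, rfl⟩
      refine ⟨Equiv.sumCongr g (Equiv.refl _), fun a => update_mem hp i a _ (good_self hσ hτ (hsc a)) ?_⟩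
      · intro u v huv
        rw [h] at huv; cases huv
        -- cross conditions with `(inl x, inl y)`
        have key1 : a = Sum.inl x ↔ (Equiv.sumCongr g (Equiv.refl (V d))) a = Sum.inl y := by
          rcases a with z | ζ
          · simp only [Equiv.sumCongr_apply, Sum.map_inl, Sum.inl.injEq]
            constructor
            · rintro rfl; exact hgx
            · intro hz; exact g.injective (hz.trans hgx.symm)
          · simp
        refine ⟨⟨key1, hsc a, ?_⟩, ⟨by rw [eq_comm, key1, eq_comm], Or.inl ⟨x, y, rfl, rfl⟩, ?_⟩⟩
        · intro a₁ b₁ a' b' ha hb ha' hb'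
          cases Sum.inl_injective ha'; cases Sum.inl_injective hb'
          subst ha
          simp only [Equiv.sumCongr_apply, Sum.map_inl, Sum.inl.injEq] at hb
          subst hb
          constructor
          · intro hx
            have : a₁ = σ.symm x := by rw [hx, Equiv.symm_apply_apply]
            rw [this, hgσ', Equiv.apply_symm_apply]
          · intro hy
            have h1 : g a₁ = g (σ.symm x) := by rw [hgσ', hy, Equiv.symm_apply_apply]
            rw [g.injective h1, Equiv.apply_symm_apply]
        · intro a₁ b₁ a' b' ha hb ha' hb'
          cases Sum.inl_injective ha; cases Sum.inl_injective hb
          subst ha'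
          simp only [Equiv.sumCongr_apply, Sum.map_inl, Sum.inl.injEq] at hb'
          subst hb'
          constructor
          · rintro rfl; exact hgσ
          · intro hy; exact g.injective (hy.trans hgσ.symm)
    · -- the other pebble sits on a dual pair `(ξ, η)`: the transposition `ξ ↔ η`
      have hsw : ∀ a : V d ⊕ V d, (∃ x y : V d, a = .inl x ∧ Equiv.swap (Sum.inr ξ) (.inr η) a = .inl y)
          ∨ ∃ α β : V d, a = .inr α ∧ Equiv.swap (Sum.inr ξ) (.inr η) a = .inr β := by
        rintro (z | ζ)
        · refine Or.inl ⟨z, z, rfl, ?_⟩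
          rw [Equiv.swap_apply_of_ne_of_ne] <;> simp
        · by_cases h1 : (Sum.inr ζ : V d ⊕ V d) = Sum.inr ξ
          · exact Or.inr ⟨ζ, η, rfl, by rw [h1, Equiv.swap_apply_left]⟩
          by_cases h2 : (Sum.inr ζ : V d ⊕ V d) = Sum.inr η
          · exact Or.inr ⟨ζ, ξ, rfl, by rw [h2, Equiv.swap_apply_right]⟩
          · exact Or.inr ⟨ζ, ζ, rfl, by rw [Equiv.swap_apply_of_ne_of_ne h1 h2]⟩
      refine ⟨Equiv.swap (Sum.inr ξ) (Sum.inr η), fun a => update_mem hp i a _ (good_self hσ hτ (hsw a)) ?_⟩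
      · intro u v huv
        rw [h] at huv; cases huv
        have key1 : a = Sum.inr ξ ↔ Equiv.swap (Sum.inr ξ) (Sum.inr η) a = Sum.inr η := by
          constructor
          · rintro rfl; exact Equiv.swap_apply_left _ _
          · intro ha
            rw [Equiv.apply_eq_iff_eq_symm_apply, Equiv.symm_swap, Equiv.swap_apply_right] at ha
            exact ha
        refine ⟨⟨key1, hsw a, ?_⟩, ⟨by rw [eq_comm, key1, eq_comm], Or.inr ⟨ξ, η, rfl, rfl⟩, ?_⟩⟩
        · intro a₁ b₁ a' b' _ _ ha' _; cases ha'
        · intro a₁ b₁ a' b' ha _ _ _; cases ha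

/-- Duplicator's strategy space. -/
def strategy (hσ : ∀ x, σ x ≠ x) (hσ2 : ∀ x, σ (σ x) ≠ x) (hτ : ∀ x, τ x ≠ x)
    (hτ2 : ∀ x, τ (τ x) ≠ x) : PebbleStrategySpace 2 (V d ⊕ V d) (V d ⊕ V d) where
  positions := positions σ τ
  empty_mem := by intro i j u v u' v' hi; simp [PebblePosition.empty] at hi
  move := fun _ hp i => move_mem hσ hσ2 hτ hτ2 hp i

/-- Two pebble pairs: three pebbled pairs with the first source distinct from the other two force
the other two to coincide. -/
theorem pigeon {M N : Type} (p : PebblePosition 2 M N) {u₀ u₁ u₂ : M} {v₀ v₁ v₂ : N}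
    (h₀ : p.Pebbled u₀ v₀) (h₁ : p.Pebbled u₁ v₁) (h₂ : p.Pebbled u₂ v₂) (h01 : u₀ ≠ u₁)
    (h02 : u₀ ≠ u₂) : u₁ = u₂ ∧ v₁ = v₂ := by
  obtain ⟨i₀, hi₀⟩ := h₀
  obtain ⟨i₁, hi₁⟩ := h₁
  obtain ⟨i₂, hi₂⟩ := h₂
  have hne1 : i₁ ≠ i₀ := by rintro rfl; rw [hi₀] at hi₁; cases hi₁; exact h01 rfl
  have hne2 : i₂ ≠ i₀ := by rintro rfl; rw [hi₀] at hi₂; cases hi₂; exact h02 rfl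
  have e1 := (fin2_eq_or_eq_rev i₀ i₁).resolve_left hne1
  have e2 := (fin2_eq_or_eq_rev i₀ i₂).resolve_left hne2
  rw [e1] at hi₁; rw [e2, hi₁] at hi₂
  cases hi₂; exact ⟨rfl, rfl⟩

/-- Members of the closure group `AGL_d` preserve `x + y + z`. -/
theorem map_add₃_of_mem {ρ : Equiv.Perm (V d)} (hρ : ρ ∈ SymmetryDialAffineOrbits.AGL d)
    (x y z : V d) : ρ (x + y + z) = ρ x + ρ y + ρ z := by
  induction hρ using Subgroup.closure_induction generalizing x y z with
  | mem ρ h => exact h x y z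
  | one => rfl
  | mul ρ ρ' _ _ ih ih' =>
    show ρ (ρ' (x + y + z)) = ρ (ρ' x) + ρ (ρ' y) + ρ (ρ' z)
    rw [ih', ih]
  | inv ρ _ ih =>
    apply ρ.injective
    rw [ih]
    simp only [Equiv.Perm.inv_def, Equiv.apply_symm_apply]

/-- **Every position of the strategy is a partial isomorphism `𝔄(I + P_σ) ⇀ 𝔄(I + P_τ)`.** -/
theorem isPartialIso_of_mem {p : PebblePosition 2 (V d ⊕ V d) (V d ⊕ V d)}
    (hp : p ∈ positions σ τ) :
    @PebblePosition.IsPartialIso 2 (V d ⊕ V d) (V d ⊕ V d) Laff (affStr (fg σ)) (affStr (fg τ)) p := by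
  classical
  have hgood : ∀ {u v u' v'}, p.Pebbled u v → p.Pebbled u' v' → Good σ τ u v u' v' :=
    fun ⟨i, hi⟩ ⟨j, hj⟩ => hp i j _ _ _ _ hi hj
  refine ⟨fun a a' b b' h h' => (hgood h h').eq_iff, ?_⟩
  intro r R xs ys hpeb
  have hsort : ∀ j, (∃ a b : V d, xs j = .inl a ∧ ys j = .inl b) ∨
      (∃ ξ η : V d, xs j = .inr ξ ∧ ys j = .inr η) := fun j => (hgood (hpeb j) (hpeb j)).sort
  -- sort dichotomies, usable on both sides
  have ptL : ∀ j, (∃ a, xs j = Sum.inl a) ↔ ∃ b, ys j = Sum.inl b := fun j => by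
    rcases hsort j with ⟨a, b, ha, hb⟩ | ⟨ξ, η, hξ, hη⟩
    · exact ⟨fun _ => ⟨b, hb⟩, fun _ => ⟨a, ha⟩⟩
    · constructor
      · rintro ⟨a, ha⟩; rw [hξ] at ha; cases ha
      · rintro ⟨b, hb⟩; rw [hη] at hb; cases hb
  have dlL : ∀ j, (∃ ξ, xs j = Sum.inr ξ) ↔ ∃ η, ys j = Sum.inr η := fun j => by
    rcases hsort j with ⟨a, b, ha, hb⟩ | ⟨ξ, η, hξ, hη⟩
    · constructor
      · rintro ⟨ξ, hξ⟩; rw [ha] at hξ; cases hξ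
      · rintro ⟨η, hη⟩; rw [hb] at hη; cases hη
    · exact ⟨fun _ => ⟨η, hη⟩, fun _ => ⟨ξ, hξ⟩⟩
  cases R with
  | pt => exact ptL 0
  | dl => exact dlL 0
  | mat =>
    show (∃ a b : V d, xs 0 = .inl a ∧ xs 1 = .inl b ∧ fg σ (a, b) = true) ↔
      (∃ a b : V d, ys 0 = .inl a ∧ ys 1 = .inl b ∧ fg τ (a, b) = true)
    rcases hsort 0 with ⟨a₀, b₀, ha₀, hb₀⟩ | ⟨ξ₀, η₀, hξ₀, hη₀⟩
    · rcases hsort 1 with ⟨a₁, b₁, ha₁, hb₁⟩ | ⟨ξ₁, η₁, hξ₁, hη₁⟩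
      · have g01 := hgood (hpeb 0) (hpeb 1)
        have g10 := hgood (hpeb 1) (hpeb 0)
        rw [ha₀, hb₀, ha₁, hb₁] at g01 g10
        have e1 : a₀ = a₁ ↔ b₀ = b₁ := by
          have := g01.eq_iff; simp only [Sum.inl.injEq] at this; exact this
        have e2 : a₀ = σ a₁ ↔ b₀ = τ b₁ := g10.nb a₁ b₁ a₀ b₀ rfl rfl rfl rfl
        constructor
        · rintro ⟨a, b, ha, hb, hab⟩
          rw [ha₀] at ha; rw [ha₁] at hb
          cases Sum.inl_injective ha; cases Sum.inl_injective hb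
          refine ⟨b₀, b₁, hb₀, hb₁, ?_⟩
          rw [fg_true] at hab ⊢
          exact hab.imp e1.1 e2.1
        · rintro ⟨a, b, ha, hb, hab⟩
          rw [hb₀] at ha; rw [hb₁] at hb
          cases Sum.inl_injective ha; cases Sum.inl_injective hb
          refine ⟨a₀, a₁, ha₀, ha₁, ?_⟩
          rw [fg_true] at hab ⊢
          exact hab.imp e1.2 e2.2
      · constructor
        · rintro ⟨a, b, -, hb, -⟩; rw [hξ₁] at hb; cases hb
        · rintro ⟨a, b, -, hb, -⟩; rw [hη₁] at hb; cases hb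
    · constructor
      · rintro ⟨a, b, ha, -, -⟩; rw [hξ₀] at ha; cases ha
      · rintro ⟨a, b, ha, -, -⟩; rw [hη₀] at ha; cases ha
  | inc =>
    show (∃ (ξ a b : V d), xs 0 = .inr ξ ∧ xs 1 = .inl a ∧ xs 2 = .inl b ∧ pair ξ (a + b) = 0) ↔
      (∃ (ξ a b : V d), ys 0 = .inr ξ ∧ ys 1 = .inl a ∧ ys 2 = .inl b ∧ pair ξ (a + b) = 0)
    rcases hsort 0 with ⟨a₀, b₀, ha₀, hb₀⟩ | ⟨ξ₀, η₀, hξ₀, hη₀⟩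
    · constructor
      · rintro ⟨ξ, a, b, h0, -, -, -⟩; rw [ha₀] at h0; cases h0
      · rintro ⟨ξ, a, b, h0, -, -, -⟩; rw [hb₀] at h0; cases h0
    rcases hsort 1 with ⟨a₁, b₁, ha₁, hb₁⟩ | ⟨ξ₁, η₁, hξ₁, hη₁⟩
    swap
    · constructor
      · rintro ⟨ξ, a, b, -, h1, -, -⟩; rw [hξ₁] at h1; cases h1
      · rintro ⟨ξ, a, b, -, h1, -, -⟩; rw [hη₁] at h1; cases h1
    rcases hsort 2 with ⟨a₂, b₂, ha₂, hb₂⟩ | ⟨ξ₂, η₂, hξ₂, hη₂⟩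
    swap
    · constructor
      · rintro ⟨ξ, a, b, -, -, h2, -⟩; rw [hξ₂] at h2; cases h2
      · rintro ⟨ξ, a, b, -, -, h2, -⟩; rw [hη₂] at h2; cases h2
    -- two pebble pairs: the two point coordinates carry the same pebbled pair
    have h0 := hpeb 0; have h1 := hpeb 1; have h2 := hpeb 2
    rw [hξ₀, hη₀] at h0; rw [ha₁, hb₁] at h1; rw [ha₂, hb₂] at h2
    obtain ⟨e12, f12⟩ := pigeon p h0 h1 h2 (by simp) (by simp)
    cases Sum.inl_injective e12; cases Sum.inl_injective f12
    have triv : ∀ (ξ a : V d), pair ξ (a + a) = 0 := fun ξ a => by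
      rw [SymmetryDialAffineOrbits.add_self]; simp [pair]
    exact ⟨fun _ => ⟨η₀, b₁, b₁, hη₀, hb₁, hb₂, triv _ _⟩, fun _ => ⟨ξ₀, a₁, a₁, hξ₀, ha₁, ha₂, triv _ _⟩⟩
  | aff =>
    show (∃ a b c e : V d, xs 0 = .inl a ∧ xs 1 = .inl b ∧ xs 2 = .inl c ∧ xs 3 = .inl e ∧
        a + b + c = e) ↔
      (∃ a b c e : V d, ys 0 = .inl a ∧ ys 1 = .inl b ∧ ys 2 = .inl c ∧ ys 3 = .inl e ∧
        a + b + c = e)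
    -- if some coordinate is a dual, both sides are false
    by_cases hall : ∀ j, ∃ a, xs j = Sum.inl a
    swap
    · push Not at hall
      obtain ⟨j, hj⟩ := hall
      have hj' : ∀ b, ys j ≠ Sum.inl b := by
        intro b hb; exact absurd ((ptL j).2 ⟨b, hb⟩) (by simpa using hj)
      constructor
      · rintro ⟨a, b, c, e, h0, h1, h2, h3, -⟩
        fin_cases j <;> [exact (hj a h0).elim; exact (hj b h1).elim; exact (hj c h2).elim;
          exact (hj e h3).elim]
      · rintro ⟨a, b, c, e, h0, h1, h2, h3, -⟩
        fin_cases j <;> [exact (hj' a h0).elim; exact (hj' b h1).elim; exact (hj' c h2).elim;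
          exact (hj' e h3).elim]
    choose x hx using hall
    have hall' : ∀ j, ∃ b, ys j = Sum.inl b := fun j => (ptL j).1 ⟨x j, hx j⟩
    choose y hy using hall'
    have hpeb' : ∀ j, p.Pebbled (Sum.inl (x j)) (Sum.inl (y j)) := fun j => by
      rw [← hx j, ← hy j]; exact hpeb j
    -- an element of `AGL_d` carrying every `x j` to `y j`
    have hexists : ∃ ρ : Equiv.Perm (V d), ρ ∈ SymmetryDialAffineOrbits.AGL d ∧ ∀ j, ρ (x j) = y j := by
      by_cases hc : ∀ j, x j = x 0
      · obtain ⟨ρ, hρ, h0⟩ := SymmetryDialAffineOrbits.exists_map_point (x 0) (y 0)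
        refine ⟨ρ, hρ, fun j => ?_⟩
        have exj : x j = x 0 := hc j
        have eyj : y j = y 0 := by
          have := (hgood (hpeb' j) (hpeb' 0)).eq_iff
          simp only [Sum.inl.injEq] at this
          exact this.1 exj
        rw [exj, eyj, h0]
      · push Not at hc
        obtain ⟨j₁, hj₁⟩ := hc
        have hyj₁ : y j₁ ≠ y 0 := by
          intro hyy
          have := (hgood (hpeb' j₁) (hpeb' 0)).eq_iff
          simp only [Sum.inl.injEq] at this
          exact hj₁ (this.2 hyy)
        obtain ⟨ρ, hρ, h0, h1⟩ := SymmetryDialAffineOrbits.exists_map_pair (Ne.symm hj₁) (Ne.symm hyj₁)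
        refine ⟨ρ, hρ, fun j => ?_⟩
        by_cases hj0 : x j = x 0
        · have eyj : y j = y 0 := by
            have := (hgood (hpeb' j) (hpeb' 0)).eq_iff
            simp only [Sum.inl.injEq] at this
            exact this.1 hj0
          rw [hj0, eyj, h0]
        · obtain ⟨exj, eyj⟩ := pigeon p (hpeb' 0) (hpeb' j₁) (hpeb' j)
            (by simpa using (Ne.symm hj₁)) (by simpa using (Ne.symm hj0))
          rw [← Sum.inl_injective exj, ← Sum.inl_injective eyj]
          exact h1
    obtain ⟨ρ, hρ, hρxy⟩ := hexists
    have hadd := map_add₃_of_mem hρ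
    constructor
    · rintro ⟨a, b, c, e, h0, h1, h2, h3, habc⟩
      rw [hx 0] at h0; rw [hx 1] at h1; rw [hx 2] at h2; rw [hx 3] at h3
      cases Sum.inl_injective h0; cases Sum.inl_injective h1
      cases Sum.inl_injective h2; cases Sum.inl_injective h3
      refine ⟨y 0, y 1, y 2, y 3, hy 0, hy 1, hy 2, hy 3, ?_⟩
      rw [← hρxy 0, ← hρxy 1, ← hρxy 2, ← hρxy 3, ← hadd, habc]
    · rintro ⟨a, b, c, e, h0, h1, h2, h3, habc⟩
      rw [hy 0] at h0; rw [hy 1] at h1; rw [hy 2] at h2; rw [hy 3] at h3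
      cases Sum.inl_injective h0; cases Sum.inl_injective h1
      cases Sum.inl_injective h2; cases Sum.inl_injective h3
      refine ⟨x 0, x 1, x 2, x 3, hx 0, hx 1, hx 2, hx 3, ?_⟩
      rw [← hρxy 0, ← hρxy 1, ← hρxy 2, ← hρxy 3, ← hadd] at habc
      exact ρ.injective habc

/-- **Two pebble pairs do not separate `𝔄(I + P_σ)` from `𝔄(I + P_τ)`** for fixed-point-free `σ, τ`
without `2`-cycles (in any dimension `d`). -/
theorem affinePebbleEquiv_two_fg (hσ : ∀ x, σ x ≠ x) (hσ2 : ∀ x, σ (σ x) ≠ x) (hτ : ∀ x, τ x ≠ x)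
    (hτ2 : ∀ x, τ (τ x) ≠ x) : AffinePebbleEquiv 2 d (fg σ) (fg τ) :=
  ⟨strategy hσ hσ2 hτ hτ2, fun _ hp => isPartialIso_of_mem hp⟩
end Game

end Summit.ValiantsHypothesis.ValiantsHypothesis.Theorems.SymmetryDialAffinePebbleTwo
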